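import Summits.BirchSwinnertonDyer.BirchSwinnertonDyer.Theorems.ManinLocalTwoThreeParamPoleJRationalRelation
import Summits.BirchSwinnertonDyer.BirchSwinnertonDyer.Theorems.ManinLocalTwoThreeParamPoleJKiller
import Literature.NumberTheory.EllipticCurves.CuspFormsGamma0IntegralBasisProofs
import HarnessLib

/-!
# Integral presentations: an `Aut(ℂ)`-fixed ratio of cusp forms is a ratio of INTEGER cusp forms

Cell `bsd-f2-manin`, prover seat p3 (gen 16), crux C3 `ManinPrimeToThreeAtNine` (stmt-22968), B-line piece (RATB)
`UDCKummerWitnessLine.KummerMinimalParamPresentation` (support file).  GENERIC linear algebra over the tree's integral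
basis of `S_w(Γ₀(N))` (`exists_basis_int_cuspCoeff`, Shimura Thm. 3.52) and the C3 LEAD's rational descent
(`RationalDescent.exists_int_of_complex_solution`, p729755):

* `exists_int_cuspForm_presentation` — for cusp forms `Nf, Df ∈ S_w(Γ₀(N))`, `Df ≠ 0`, `w ≥ 2`, whose Laurent
  ratio `N̂f/D̂f ∈ ℂ((q))` is fixed coefficientwise by every automorphism of `ℂ`, there are cusp forms `Bn, Bd ∈ S_w(Γ₀(N))`
  with INTEGER Fourier coefficients, `Bd ≠ 0`, and `Bd·Nf = Bn·Df` (so `Bn/Bd = Nf/Df`): the unknown coordinates of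
  `(Bd, Bn)` in an integer basis satisfy a ℚ-linear system (one equation per `q`-power) with the complex solution
  `(Df, Nf)` off the rational hyperplane "coefficient `n₀` of `B̂d` is `0`".
* `hasSum_int_qExpansion` — a modular form on `Γ₀(N)` with integer `q`-expansion coefficients is an integer
  `q`-series `Σ bₙ e^{2πiτn}` on all of `ℍ`.

Everything is proved; no named fact.  BSD is not proved by this; C2/C3 are not proved by this.
-/

set_option linter.dupNamespace false

noncomputable section

open Complex Filter Topology Set Function
open UpperHalfPlane hiding I
open scoped Real Topology Manifold MatrixGroups PeriodPair ModularForm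
open ModularForm EisensteinSeries SlashInvariantForm ModularFormClass CongruenceSubgroup PowerSeries
open Literature.NumberTheory.EllipticCurves Literature.NumberTheory.EllipticCurves.ModularForms

namespace Summit.BirchSwinnertonDyer.BirchSwinnertonDyer.Theorems.ManinLocalTwoThree.ParamPoleJ

variable {N : ℕ} [NeZero N]

/-! ### Integer `q`-expansions -/

omit [NeZero N] in
/-- A cusp form with integer Fourier coefficients has a `σ`-fixed Laurent `q`-series. [folklore] -/
theorem mapLaurent_qExpansionL_of_int {w : ℤ} (g : CuspForm (Gamma0 N) w) (hg : ∀ m, ∃ z : ℤ, cuspCoeff g m = z)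
    (σ : ℂ ≃+* ℂ) : mapLaurent (σ : ℂ →+* ℂ) (qExpansionL N (g : ModularForm (Gamma0 N) w)) =
      qExpansionL N (g : ModularForm (Gamma0 N) w) := by
  rw [qExpansionL_def, mapLaurent_coe_powerSeries]
  congr 1
  ext m
  obtain ⟨z, hz⟩ := hg m
  rw [coeff_map, show (qExpansion 1 ⇑(g : ModularForm (Gamma0 N) w)).coeff m = cuspCoeff g m from rfl, hz]
  exact map_intCast _ z

/-- **A modular form on `Γ₀(N)` with integer `q`-expansion is an integer `q`-series on `ℍ`.** [folklore] -/
theorem hasSum_int_qExpansion {w : ℤ} (M : ModularForm (Gamma0 N) w) (b : ℕ → ℤ)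
    (hb : ∀ m, (qExpansion 1 ⇑M).coeff m = b m) (τ : ℍ) :
    HasSum (fun m : ℕ ↦ (b m : ℂ) * Complex.exp (2 * Real.pi * Complex.I * (τ : ℂ) * m)) (M τ) := by
  have h := UpperHalfPlane.hasSum_qExpansion one_pos
    (SlashInvariantFormClass.periodic_comp_ofComplex M (one_mem_strictPeriods_coe_gamma0 N))
    (ModularFormClass.holo M) (ModularFormClass.bdd_at_infty M) τ
  convert h using 2 with m
  rw [hb, smul_eq_mul, Function.Periodic.qParam, ← Complex.exp_nat_mul]
  congr 1
  push_cast
  ring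

/-! ### The descent -/

/-- **An `Aut(ℂ)`-fixed ratio of cusp forms is a ratio of integer cusp forms.**  [cite: ShimuraIATAF1971, Thm. 3.52] -/
theorem exists_int_cuspForm_presentation {w : ℤ} (hw : 2 ≤ w) (Nf Df : CuspForm (Gamma0 N) w) (hD : Df ≠ 0)
    (hfix : ∀ σ : ℂ ≃+* ℂ, mapLaurent (σ : ℂ →+* ℂ)
      (qExpansionL N (Nf : ModularForm (Gamma0 N) w) / qExpansionL N (Df : ModularForm (Gamma0 N) w)) =
      qExpansionL N (Nf : ModularForm (Gamma0 N) w) / qExpansionL N (Df : ModularForm (Gamma0 N) w)) :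
    ∃ Bn Bd : CuspForm (Gamma0 N) w, Bd ≠ 0 ∧ (∀ m, ∃ z : ℤ, cuspCoeff Bd m = z) ∧ (∀ m, ∃ z : ℤ, cuspCoeff Bn m = z) ∧
      (Bd : ModularForm (Gamma0 N) w).mul (Nf : ModularForm (Gamma0 N) w) =
        (Bn : ModularForm (Gamma0 N) w).mul (Df : ModularForm (Gamma0 N) w) := by
  classical
  obtain ⟨r, g, hg⟩ := exists_basis_int_cuspCoeff N w hw
  set Nh : LaurentSeries ℂ := qExpansionL N (Nf : ModularForm (Gamma0 N) w) with hNh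
  set Dh : LaurentSeries ℂ := qExpansionL N (Df : ModularForm (Gamma0 N) w) with hDh
  set H : LaurentSeries ℂ := Nh / Dh with hH
  have hDf0 : (Df : ModularForm (Gamma0 N) w) ≠ 0 := fun h0 ↦ hD (by
    apply DFunLike.ext; intro τ; exact DFunLike.congr_fun h0 τ)
  have hDh0 : Dh ≠ 0 := (qExpansionL_eq_zero_iff N _).not.mpr hDf0
  have hDH : Dh * H = Nh := by rw [hH, mul_div_cancel₀ _ hDh0]
  -- linear structure of `c ↦ Σ cᵢ gᵢ`
  have cusp_coe_sum : ∀ c : Fin r → ℂ, (⇑(∑ i, c i • g i : CuspForm (Gamma0 N) w) : ℍ → ℂ) = ∑ i, c i • ⇑(g i) := by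
    intro c
    change CuspForm.coeHom (∑ i, c i • g i) = _
    rw [map_sum]
    rfl
  have toMF_sum : ∀ c : Fin r → ℂ, ((∑ i, c i • g i : CuspForm (Gamma0 N) w) : ModularForm (Gamma0 N) w) =
      ∑ i, c i • (g i : ModularForm (Gamma0 N) w) := by
    intro c
    apply DFunLike.ext
    intro τ
    change (⇑(∑ i, c i • g i : CuspForm (Gamma0 N) w)) τ = _
    rw [cusp_coe_sum, coe_finset_sum, Finset.sum_apply, Finset.sum_apply]
    refine Finset.sum_congr rfl fun i _ ↦ ?_
    rw [Pi.smul_apply, IsGLPos.smul_apply]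
    rfl
  have qL_sum : ∀ c : Fin r → ℂ, qExpansionL N ((∑ i, c i • g i : CuspForm (Gamma0 N) w) : ModularForm (Gamma0 N) w) =
      ∑ i, c i • qExpansionL N (g i : ModularForm (Gamma0 N) w) := by
    intro c
    rw [toMF_sum, ← qExpansionLₗ_apply, map_sum]
    simp only [map_smul, qExpansionLₗ_apply]
  have cuspCoeff_sum : ∀ (c : Fin r → ℂ) (m : ℕ), cuspCoeff (∑ i, c i • g i) m = ∑ i, c i * cuspCoeff (g i) m :=
    fun c m ↦ cuspCoeff_sum_smul Finset.univ c g m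
  -- integer / rational data
  choose zg hzg using hg
  have hgfix : ∀ i (σ : ℂ ≃+* ℂ), mapLaurent (σ : ℂ →+* ℂ) (qExpansionL N (g i : ModularForm (Gamma0 N) w)) =
      qExpansionL N (g i : ModularForm (Gamma0 N) w) := fun i σ ↦
    mapLaurent_qExpansionL_of_int (g i) (fun m ↦ ⟨zg i m, hzg i m⟩) σ
  have hcoefH : ∀ i : Fin r, ∃ a : ℤ → ℚ, ∀ s, ((a s : ℚ) : ℂ) =
      (qExpansionL N (g i : ModularForm (Gamma0 N) w) * H).coeff s := fun i ↦
    exists_ratCast_coeff_of_forall_mapLaurent fun σ ↦ by rw [map_mul, hgfix i σ, hH, hfix σ]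
  choose a ha using hcoefH
  have hgcoef : ∀ (i : Fin r) (s : ℤ), (qExpansionL N (g i : ModularForm (Gamma0 N) w)).coeff s =
      (((if s < 0 then 0 else (zg i s.natAbs : ℚ)) : ℚ) : ℂ) := by
    intro i s
    rw [qExpansionL_def, PowerSeries.coeff_coe]
    by_cases hs : s < 0
    · rw [if_pos hs, if_pos hs, Rat.cast_zero]
    · rw [if_neg hs, if_neg hs, Rat.cast_intCast, ← hzg i]; rfl
  -- the ℚ-linear system and its complex solution
  let A : ℤ → (Fin r ⊕ Fin r) → ℚ := fun s j ↦ match j with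
    | Sum.inl i => a i s
    | Sum.inr i => -(if s < 0 then 0 else (zg i s.natAbs : ℚ))
  let x : Fin r ⊕ Fin r → ℂ := fun j ↦ match j with
    | Sum.inl i => g.repr Df i
    | Sum.inr i => g.repr Nf i
  have hreprD : Dh = ∑ i, g.repr Df i • qExpansionL N (g i : ModularForm (Gamma0 N) w) := by
    rw [hDh, ← qL_sum]; congr 2; exact (g.sum_repr Df).symm
  have hreprN : Nh = ∑ i, g.repr Nf i • qExpansionL N (g i : ModularForm (Gamma0 N) w) := by
    rw [hNh, ← qL_sum]; congr 2; exact (g.sum_repr Nf).symm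
  have hsys : ∀ s : ℤ, ∑ j, ((A s j : ℚ) : ℂ) * x j = 0 := by
    intro s
    have h1 : (Dh * H).coeff s = Nh.coeff s := by rw [hDH]
    rw [hreprD, Finset.sum_mul, hreprN, HahnSeries.coeff_sum, HahnSeries.coeff_sum] at h1
    rw [Fintype.sum_sum_type]
    simp only [A, x]
    have e1 : ∑ i : Fin r, ((a i s : ℚ) : ℂ) * g.repr Df i =
        ∑ i : Fin r, (g.repr Df i • qExpansionL N (g i : ModularForm (Gamma0 N) w) * H).coeff s := by
      refine Finset.sum_congr rfl fun i _ ↦ ?_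
      rw [← HahnSeries.C_mul_eq_smul, mul_assoc, HahnSeries.C_mul_eq_smul, HahnSeries.coeff_smul, smul_eq_mul,
        ← ha i s, mul_comm]
    have e2 : ∑ i : Fin r, (((-(if s < 0 then 0 else (zg i s.natAbs : ℚ)) : ℚ)) : ℂ) * g.repr Nf i =
        -∑ i : Fin r, (g.repr Nf i • qExpansionL N (g i : ModularForm (Gamma0 N) w)).coeff s := by
      rw [← Finset.sum_neg_distrib]
      refine Finset.sum_congr rfl fun i _ ↦ ?_
      rw [HahnSeries.coeff_smul, smul_eq_mul, hgcoef i s, Rat.cast_neg]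
      ring
    rw [e1, e2, h1, add_neg_cancel]
  -- the non-vanishing functional: a nonzero coefficient of `D̂f`
  obtain ⟨n₀, hn₀⟩ : ∃ n₀ : ℕ, cuspCoeff Df n₀ ≠ 0 := by
    by_contra hall
    push Not at hall
    apply hDf0
    rw [← qExpansionL_eq_zero_iff, qExpansionL_def]
    have : qExpansion 1 ⇑(Df : ModularForm (Gamma0 N) w) = 0 := by
      ext m; exact hall m
    rw [this, PowerSeries.coe_zero]
  let b : (Fin r ⊕ Fin r) → ℚ := fun j ↦ match j with
    | Sum.inl i => (zg i n₀ : ℚ)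
    | Sum.inr _ => 0
  have hb : ∑ j, ((b j : ℚ) : ℂ) * x j ≠ 0 := by
    rw [Fintype.sum_sum_type]
    simp only [b, x, Rat.cast_zero, zero_mul, Finset.sum_const_zero, add_zero]
    have : cuspCoeff Df n₀ = ∑ i : Fin r, ((zg i n₀ : ℚ) : ℂ) * g.repr Df i := by
      conv_lhs => rw [← g.sum_repr Df]
      rw [cuspCoeff_sum]
      refine Finset.sum_congr rfl fun i _ ↦ ?_
      rw [hzg i n₀]; push_cast; ring
    rwa [← this]
  obtain ⟨z, hz, hzb⟩ := RationalDescent.exists_int_of_complex_solution A b x hsys hb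
  -- the integer forms: `Bd` from the `inl`-coordinates, `Bn` from the `inr`-coordinates
  set Bd : CuspForm (Gamma0 N) w := ∑ i, ((z (Sum.inl i) : ℤ) : ℂ) • g i with hBd
  set Bn : CuspForm (Gamma0 N) w := ∑ i, ((z (Sum.inr i) : ℤ) : ℂ) • g i with hBn
  have hsmul_coeff : ∀ (c : ℂ) (Y : LaurentSeries ℂ) (s : ℤ), (c • Y).coeff s = c * Y.coeff s :=
    fun c Y s ↦ by rw [HahnSeries.coeff_smul, smul_eq_mul]
  have hsmul_mul : ∀ (c : ℂ) (Y Z : LaurentSeries ℂ), c • Y * Z = c • (Y * Z) := fun c Y Z ↦ by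
    rw [← HahnSeries.C_mul_eq_smul, ← HahnSeries.C_mul_eq_smul, mul_assoc]
  refine ⟨Bn, Bd, ?_, ?_, ?_, ?_⟩
  · -- `Bd ≠ 0`: its `n₀`-th coefficient is `Σ zg i n₀ * z (inl i) ≠ 0`
    intro h0
    apply hzb
    have h1 := congrArg (fun B : CuspForm (Gamma0 N) w ↦ cuspCoeff B n₀) h0
    simp only [hBd, cuspCoeff_sum] at h1
    rw [show cuspCoeff (0 : CuspForm (Gamma0 N) w) n₀ = 0 from by
      change (qExpansion 1 ⇑(0 : CuspForm (Gamma0 N) w)).coeff n₀ = 0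
      rw [CuspForm.coe_zero, UpperHalfPlane.qExpansion_zero, map_zero]] at h1
    rw [Fintype.sum_sum_type]
    simp only [b, zero_mul, Finset.sum_const_zero, add_zero]
    have : ((∑ i : Fin r, (zg i n₀ : ℚ) * (z (Sum.inl i) : ℚ) : ℚ) : ℂ) = 0 := by
      push_cast
      rw [← h1]
      refine Finset.sum_congr rfl fun i _ ↦ ?_
      rw [hzg i n₀]; ring
    exact_mod_cast this
  · intro m
    refine ⟨∑ i, z (Sum.inl i) * zg i m, ?_⟩
    rw [hBd, cuspCoeff_sum]; push_cast
    exact Finset.sum_congr rfl fun i _ ↦ by rw [hzg i m]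
  · intro m
    refine ⟨∑ i, z (Sum.inr i) * zg i m, ?_⟩
    rw [hBn, cuspCoeff_sum]; push_cast
    exact Finset.sum_congr rfl fun i _ ↦ by rw [hzg i m]
  · -- `Bd·Nf = Bn·Df` from `B̂d·H = B̂n`
    set Bdh : LaurentSeries ℂ := ∑ i, ((z (Sum.inl i) : ℤ) : ℂ) • qExpansionL N (g i : ModularForm (Gamma0 N) w)
      with hBdh
    set Bnh : LaurentSeries ℂ := ∑ i, ((z (Sum.inr i) : ℤ) : ℂ) • qExpansionL N (g i : ModularForm (Gamma0 N) w)
      with hBnh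
    have hcoef : ∀ s : ℤ, (Bdh * H).coeff s = Bnh.coeff s := by
      intro s
      have h1 := hz s
      rw [Fintype.sum_sum_type] at h1
      simp only [A] at h1
      have e1 : (Bdh * H).coeff s = ((∑ i : Fin r, a i s * (z (Sum.inl i) : ℚ) : ℚ) : ℂ) := by
        rw [hBdh, Finset.sum_mul, HahnSeries.coeff_sum, Rat.cast_sum]
        refine Finset.sum_congr rfl fun i _ ↦ ?_
        rw [hsmul_mul, hsmul_coeff, ← ha i s]; push_cast; ring
      have e2 : Bnh.coeff s = ((∑ i : Fin r, (if s < 0 then 0 else (zg i s.natAbs : ℚ)) * (z (Sum.inr i) : ℚ) : ℚ) : ℂ) := by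
        rw [hBnh, HahnSeries.coeff_sum, Rat.cast_sum]
        refine Finset.sum_congr rfl fun i _ ↦ ?_
        rw [hsmul_coeff, hgcoef i s]; push_cast; ring
      rw [e1, e2]
      congr 1
      simp only [neg_mul, Finset.sum_neg_distrib] at h1
      linear_combination h1
    have hBH : Bdh * H = Bnh := HahnSeries.ext (funext hcoef)
    have hq : qExpansionL N ((Bd : ModularForm (Gamma0 N) w).mul (Nf : ModularForm (Gamma0 N) w)) =
        qExpansionL N ((Bn : ModularForm (Gamma0 N) w).mul (Df : ModularForm (Gamma0 N) w)) := by
      rw [qExpansionL_mul, qExpansionL_mul, hBd, hBn, qL_sum, qL_sum, ← hBdh, ← hBnh, ← hNh, ← hDh, ← hBH, ← hDH]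
      ring
    have h0 : qExpansionL N ((Bd : ModularForm (Gamma0 N) w).mul (Nf : ModularForm (Gamma0 N) w) -
        (Bn : ModularForm (Gamma0 N) w).mul (Df : ModularForm (Gamma0 N) w)) = 0 := by
      rw [sub_eq_add_neg, qExpansionL_add, qExpansionL_neg, hq, add_neg_cancel]
    exact sub_eq_zero.mp ((qExpansionL_eq_zero_iff N _).mp h0)

end Summit.BirchSwinnertonDyer.BirchSwinnertonDyer.Theorems.ManinLocalTwoThree.ParamPoleJ

end
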